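import Summits.QuantumFields.BalabanUV.Beta.GAN24.TaylorTrilinear
import Summits.QuantumFields.BalabanUV.Beta.GAN24.E3UnitSplit
import Summits.QuantumFields.BalabanUV.Beta.GAN24.WilsonVertexSumZero
import Summits.QuantumFields.BalabanUV.Beta.GAN24.FineReadoutGradientDecay
import Literature.MathematicalPhysics.QuantumFieldTheory.Balaban1983to89.T4GaugeActionRatePair

/-!
# `BalabanUV.Beta.GAN24.TaylorRowW` — binder row G-an2-4 ∕ (CONV-C), S-slot, road «S3-Taylor»: SHAPE-TABLE ROW W (the Wilson piece of
# «E3Shape») — `rowW_of_fineReadout` (generic assembly modulo the two leg inputs (N1) ∕ (N1′)) and **`rowW_three`** (d = 3, UNCONDITIONAL: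
# (N1) ∕ (N1′) BY NAME) (`SKELETON-S3.md` v1.1 §12.2 ∕ §16 «ROW W»; LEAVES.md PART III § III.S row S3-W; journal INTENT «ROW-W*»; row owner gan24-p1-g4)

G-an2-4 formalisation swarm, leaf prover 19 (unit `b2b-balaban-gan24-formalise-leaf-19`, gens 13–14; author of W3 `GAN24/TaylorTrilinear` and of
the (N1′) packaging `GAN24/FineReadoutGradientDecay`).  HONEST FRAMING (cell rule, verbatim): «discharging `BetaPertH` makes Bałaban's UV stability
UNCONDITIONAL — a real constructive-QFT result; it is NOT the continuum limit and NOT the Clay problem.»  HONEST DEPENDENCY (verbatim): «continuum YM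
on T⁴ ⇐ BetaPertH ∧ nine spine estimates (0/9 proved); BetaPertH ⇐ (D1) ∧ (D4) ∧ CAP+tail; G-an2-4 gates asym, D1 and NE2/3/4.»  NOT IN PRINT; OUR
PROOF ATTEMPT: §2–§3 prove the row MODULO two EXPLICIT hypotheses — (N1) and (N1′), the `N`-uniform block-label decay and unit gradients of the
normalised minimiser column `H̃_N = N^{d+2}·wH_N` of an2's typed `U = 1` KKT system — stated in the block-label `ℓ¹` currency the row owner ADOPTED
(RULINGS-5); §5 DISCHARGES both BY NAME at `d = 3` from the tree: (N1) = leaf-16's `FineReadoutDecay.exists_wH_decay`, (N1′) =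
`FineReadoutGradientDecay.exists_wH_grad_decay` (joint form `exists_wH_decay_and_grad`), both resting on road P1's `FibreDetStripHolds.exists_strip`.
[folklore] bookkeeping otherwise; nothing is cited, no `def … : Prop` is minted; every input is a tree theorem BY NAME.  Statement of `rowW_three` =
the hypothesis `hW` of the owner's END `StencilSlotE3OfPieces.e3Shape_of_pieces` at `d = 3` (= the binder `hW`, l.158–159, of the TREE module
`GAN24/StencilSlotE3OfPieces` p206983, textually, with `d := 3`; first copied from the staged draft 2cc3c5eb8d83de1a), over the
TREE objects `E3UnitSplit.e3OfS` ∕ `StepJetData.wilsonA` ∕ `OneStepResolventKernel.LocStencil` only.  It is ONE of twelve analytic rows and discharges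
NOTHING of (hS, hSall) by itself; «E3Shape»∕«E3SupRate» remain OPEN.  NOT BetaPertH, NOT continuum, NOT Clay.

## What is proved (`0 sorry`)
* §1 the Wilson table as a W3 table: `abs_wilsonA_le` (`|wilsonA| ≤ wBound d`, `StepJetData.locStencil_wilsonA` at rate 0),
  `not_mem_suppW_of_sub_not_mem`, `wilsonA_eq_zero_of_left`∕`_of_right` (finite range `BalabanStepJets.box1 (d+1)` in both offsets, by
  leaf-15's `WilsonVertexSumZero.wilsonA_eq_zero_left`∕`_right` + `suppW_subset_box`), **`wilsonA_sum_zero_offsets`** (W1 in offset form: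
  `Σ_{s,t ∈ box1} wilsonA d κ u (u+s) (u+t) (inl l) (inl l′) = 0`, = `WilsonVertexSumZero.wilsonA_sum_zero_box` re-indexed).
* §2 `quo_sub_zsmul`; **`locStencil_wilson_piece`** (GENERIC `d`): under (N1) `|((Lc:ℝ)^(j+1))^(d+2)·wH_{Lc^(j+1)} κ l z| ≤ C_H·e^{−δ|quo z|₁}`
  and (N1′) `|((Lc:ℝ)^(j+1))^(d+2)·(wH κ l (z + e_ν) − wH κ l z)| ≤ (C′_H/Lc^(j+1))·e^{−δ|quo z|₁}` for all levels `j`, the Wilson piece of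
  the normalised third jet at member `n+2` — the hypothesis `hW` of `StencilSlotE3OfPieces.e3Shape_of_pieces` LITERALLY — is
  `LocStencil … (|−(cE/Lc^{d+1})·((Lc:ℝ)^(n+2))^{(d:ℤ)−3}|·C_W) (δ/2)` with
  `C_W = (d+1)³·|box1 (d+1)|²·wBound d·C_H·(d+1)·e^{2δ(d+1)}·(C′_H C_H + C_H C′_H)·Zl_{d+1}(δ/2)` FREE OF `n`: W3
  `TaylorTrilinear.locStencil_of_trilinear` at the instantiation `G := N^{d+2}GamΦ_N = −H̃ᵀ` (`ResolventComposition.GamΦ_eq_neg_wH`),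
  `H = K := H̃`, `T := wilsonA`, `B := box1 (d+1)` (`l1_le_of_mem_box1`), `scal := −(cE/Lc^{d+1})·N^{d−3}` (`E3UnitSplit.e3W_unit_split`,
  leaf-01), zero entries by `e3OfS_inl_inr`∕`e3OfS_inr`.
* §3 **`rowW_of_fineReadout`** (`d = 3`): the residual is `N⁰ = 1`, so (N1) ∧ (N1′) ⟹ `∃ CW δW, 0 < δW ∧ ∀ n, LocStencil (fun κ′ u′ x′ z′ a b
  ↦ ((Lc:ℝ)^(n+1+1))^(2*(3+1)) * e3OfS (Lc^(n+1+1)) (fun κ u ↦ (cE * ((Lc:ℝ)^(3+1))^(n+1)) • wilsonA 3 κ u) κ′ u′ x′ z′ a b) CW δW` — ROW W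
  REDUCED IN THE KERNEL to the two leg estimates (discharged BY NAME in §5; their sup-norm `‖quo ·‖∞` form implies the `ℓ¹` form at
  `δ := κ₀/(d+1)`, §4).
* §4 CURRENCY ADAPTERS `legBound_of_supNorm_form` ∕ `legGrad_of_supNorm_form` (leaf-16's sup-norm ∕ inverse-power shapes ⇒ the adopted
  `ℓ¹` shapes at rate `κ₀/(d+1)`) and **`rowW_of_supNorm_forms`** (`d = 3`: row W straight from the `exists_wH_decay`-shaped (N1) and
  the matching `((Lc^(j+1))^{d+3})⁻¹`-shaped (N1′)).
* §5 **`rowW_three`** (`d = 3`, every `Lc ≥ 1`, every `cE`): `∃ CW δW, 0 < δW ∧ ∀ n, LocStencil (…row W's family at member n+2…) CW δW` —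
  UNCONDITIONAL: `rowW_of_supNorm_forms` fed with `FineReadoutGradientDecay.exists_wH_decay_and_grad` ((N1) ∧ (N1′) at one common rate).
NOT HERE: (N1)∕(N1′) themselves (leaf-16's `FineReadoutDecay`, `FineReadoutGradientDecay`); the other eleven rows; the common-rate bookkeeping of the
END (`locStencil_mono` in δ, the assembler's).
-/

noncomputable section

open Finset
open scoped BigOperators
open Literature.MathematicalPhysics.QuantumFieldTheory Balaban1983to89 Balaban1983to89.Beta
open B12Sec2to5 (l1 l1_nonneg)
open ExpKernelCalculus (MKer Zl)
open OneStepResolventKernel (Fib LocStencil)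
open LatticeForm (quo)
open B4ContourShift (supNorm abs_le_supNorm supNorm_nonneg)
open KernelSpecInstance (wH)
open KKTFluctuationKernel (GamΦ)
open ResolventComposition (GamΦ_eq_neg_wH)
open StepJetData (wilsonA wBound wBound_nonneg locStencil_wilsonA)
open BalabanStepJets (box1 mem_box1 l1_le_of_mem_box1)
open Summit.QuantumFields.BalabanUV.Beta.GAN24.E3UnitSplit (e3OfS e3W_unit_split e3OfS_inl_inr e3OfS_inr)
open Summit.QuantumFields.BalabanUV.Beta.GAN24.WilsonVertexSumZero (suppW wilsonA_eq_zero_left wilsonA_eq_zero_right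
  suppW_subset_box wilsonA_sum_zero_box)
open Summit.QuantumFields.BalabanUV.Beta.GAN24.TaylorTrilinear (locStencil_of_trilinear)
open Summit.QuantumFields.BalabanUV.Beta.GAN24.FineReadoutGradientDecay (exists_wH_decay_and_grad)
open Summit.QuantumFields.BalabanUV.Beta.GAN24.CombesThomasFibre (quo_sub_zsmul)
open T4GaugeActionRatePair (exp_sup_le_exp_l1)

namespace Summit.QuantumFields.BalabanUV.Beta.GAN24.TaylorRowW

variable {d : ℕ}

/-! ## §1 The Wilson table as a W3 table: bound, finite range `box1`, vanishing row sums (W1 BY NAME) -/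

/-- [folklore] Entrywise bound of the antisymmetrised Wilson table (`StepJetData.locStencil_wilsonA` at rate `0`). -/
theorem abs_wilsonA_le (κ : Fin (d + 1)) (u w y : Fin (d + 1) → ℤ) (a b : Fib d) : |wilsonA d κ u w y a b| ≤ wBound d := by
  have h := locStencil_wilsonA (d := d) (le_refl (0 : ℝ)) κ u w y a b
  simpa only [mul_zero, Real.exp_zero, mul_one, neg_zero, zero_mul] using h

/-- [folklore] Off the box `u + {−1,0,1}^{d+1}` a site is outside the table's support set. -/
theorem not_mem_suppW_of_sub_not_mem (κ : Fin (d + 1)) (u : Fin (d + 1) → ℤ) {w : Fin (d + 1) → ℤ}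
    (hw : w - u ∉ box1 (d + 1)) : w ∉ suppW κ u := by
  intro hmem
  obtain ⟨v, hv, hvw⟩ := Finset.mem_image.1 (suppW_subset_box κ u hmem)
  exact hw (by rw [← hvw, add_sub_cancel_left]; exact hv)

/-- [folklore] The table vanishes unless the first leg lies in the box around the vertex location. -/
theorem wilsonA_eq_zero_of_left (κ : Fin (d + 1)) (u w y : Fin (d + 1) → ℤ) (l l' : Fin (d + 1))
    (hw : w - u ∉ box1 (d + 1)) : wilsonA d κ u w y (Sum.inl l) (Sum.inl l') = 0 :=
  wilsonA_eq_zero_left κ u (not_mem_suppW_of_sub_not_mem κ u hw) y l l'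

/-- [folklore] The table vanishes unless the second leg lies in the box around the vertex location. -/
theorem wilsonA_eq_zero_of_right (κ : Fin (d + 1)) (u w y : Fin (d + 1) → ℤ) (l l' : Fin (d + 1))
    (hy : y - u ∉ box1 (d + 1)) : wilsonA d κ u w y (Sum.inl l) (Sum.inl l') = 0 :=
  wilsonA_eq_zero_right κ u w (not_mem_suppW_of_sub_not_mem κ u hy) l l'

/-- [folklore] **W1 IN OFFSET FORM** (leaf-15's `WilsonVertexSumZero.wilsonA_sum_zero_box` BY NAME, re-indexed by the offsets):
`Σ_{s,t ∈ box1} wilsonA d κ u (u+s) (u+t) (inl l) (inl l′) = 0`. -/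
theorem wilsonA_sum_zero_offsets (κ : Fin (d + 1)) (u : Fin (d + 1) → ℤ) (l l' : Fin (d + 1)) :
    ∑ s ∈ box1 (d + 1), ∑ t ∈ box1 (d + 1), wilsonA d κ u (u + s) (u + t) (Sum.inl l) (Sum.inl l') = 0 := by
  have h := wilsonA_sum_zero_box (d := d) κ u l l'
  have hinj : ∀ a ∈ box1 (d + 1), ∀ b ∈ box1 (d + 1), u + a = u + b → a = b := fun a _ b _ hab => add_left_cancel hab
  rw [Finset.sum_image hinj] at h
  simp_rw [Finset.sum_image hinj] at h
  exact h

/-! ## §2 Row W modulo (N1) ∕ (N1′), generic `d` (residual `N^{d−3}` displayed) -/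

section Generic

variable {Lc : ℕ} [NeZero Lc]

/-- [folklore] **ROW W MODULO (N1)∕(N1′), GENERIC `d`.**  With the normalised minimiser column `H̃_N := N^{d+2}·wH_N` bounded and
unit-Lipschitz in the ADOPTED block-label `ℓ¹` currency, uniformly over the levels `N = Lc^{j+1}` —
(N1) `|H̃_N κ l z| ≤ C_H·e^{−δ|quo N z|₁}`, (N1′) `|H̃_N κ l (z + e_ν) − H̃_N κ l z| ≤ (C′_H/N)·e^{−δ|quo N z|₁}` — the Wilson piece of the
normalised third jet at member `n+2` (the hypothesis `hW` of `StencilSlotE3OfPieces.e3Shape_of_pieces`, literally) is a local stencil family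
with rate `δ/2` and constant `|cE/Lc^{d+1}|·N^{d−3}·C_W`, `C_W` free of `n` — W3 `TaylorTrilinear.locStencil_of_trilinear` at the instantiation of
`E3UnitSplit.e3W_unit_split` (legs `G̃ = −H̃ᵀ` by `GamΦ_eq_neg_wH`; table `wilsonA`, box `box1 (d+1)`, W1 `wilsonA_sum_zero_offsets`). -/
theorem locStencil_wilson_piece (cE : ℝ) {δ CH CH' : ℝ} (hδ : 0 < δ)
    (hN1 : ∀ (j : ℕ) (κ l : Fin (d + 1)) (z : Fin (d + 1) → ℤ),
      |((Lc : ℝ) ^ (j + 1)) ^ (d + 2) * wH (N := Lc ^ (j + 1)) κ l z| ≤ CH * Real.exp (-δ * l1 (quo (Lc ^ (j + 1)) z)))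
    (hN1' : ∀ (j : ℕ) (κ l : Fin (d + 1)) (z : Fin (d + 1) → ℤ) (ν : Fin (d + 1)),
      |((Lc : ℝ) ^ (j + 1)) ^ (d + 2) * (wH (N := Lc ^ (j + 1)) κ l (z + Pi.single ν 1) - wH (N := Lc ^ (j + 1)) κ l z)| ≤
        CH' / (Lc : ℝ) ^ (j + 1) * Real.exp (-δ * l1 (quo (Lc ^ (j + 1)) z)))
    (n : ℕ) :
    LocStencil (fun κ' u' x' z' a b => ((Lc : ℝ) ^ (n + 1 + 1)) ^ (2 * (d + 1)) *
        e3OfS (Lc ^ (n + 1 + 1)) (fun κ u => (cE * ((Lc : ℝ) ^ (d + 1)) ^ (n + 1)) • wilsonA d κ u) κ' u' x' z' a b)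
      (|-(cE / (Lc : ℝ) ^ (d + 1)) * ((Lc : ℝ) ^ (n + 1 + 1)) ^ ((d : ℤ) - 3)| *
        (((d : ℝ) + 1) ^ 3 * ((box1 (d + 1)).card : ℝ) ^ 2 * wBound d * CH * ((d : ℝ) + 1) * Real.exp (2 * δ * ((d : ℝ) + 1)) *
          (CH' * CH + CH * CH') * Zl (d + 1) (δ / 2))) (δ / 2) := by
  have hcast : ((Lc ^ (n + 1 + 1) : ℕ) : ℝ) = (Lc : ℝ) ^ (n + 1 + 1) := by push_cast; rfl
  have hre : ∀ c A B : ℝ, c * -A - c * -B = -(c * (A - B)) := fun c A B => by ring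
  -- the three legs, the table, the box
  refine locStencil_of_trilinear (Lc ^ (n + 1 + 1))
    (fun α x' l w => ((Lc : ℝ) ^ (n + 1 + 1)) ^ (d + 2) * GamΦ (N := Lc ^ (n + 1 + 1)) α x' l w)
    (fun κ' u' κ u => ((Lc : ℝ) ^ (n + 1 + 1)) ^ (d + 2) * wH (N := Lc ^ (n + 1 + 1)) κ κ' (u - ((Lc ^ (n + 1 + 1) : ℕ) : ℤ) • u'))
    (fun β z' l' y => ((Lc : ℝ) ^ (n + 1 + 1)) ^ (d + 2) * wH (N := Lc ^ (n + 1 + 1)) l' β (y - ((Lc ^ (n + 1 + 1) : ℕ) : ℤ) • z'))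
    (fun κ u w y l l' => wilsonA d κ u w y (Sum.inl l) (Sum.inl l')) (box1 (d + 1))
    (-(cE / (Lc : ℝ) ^ (d + 1)) * ((Lc : ℝ) ^ (n + 1 + 1)) ^ ((d : ℤ) - 3)) _
    (CG := CH) (CG' := CH') (CK := CH) (CK' := CH') (CH := CH) (CT := wBound d) (RB := (d : ℝ) + 1)
    hδ ?_ ?_ ?_ ?_ ?_ ?_ ?_ ?_ ?_ ?_ ?_ ?_ ?_
  · -- the (inl, inl) entries: `e3W_unit_split` at member n+2
    intro κ' u' x' z' α β
    rw [hcast]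
    exact e3W_unit_split cE (n + 1) κ' u' x' z' α β
  · intro κ' u' x' z' α ν
    rw [e3OfS_inl_inr, mul_zero]
  · intro κ' u' x' z' μ b
    rw [e3OfS_inr, mul_zero]
  · -- (hG): the row leg is minus the column leg
    intro α x' l w
    rw [GamΦ_eq_neg_wH, mul_neg, abs_neg, ← quo_sub_zsmul (N := Lc ^ (n + 1 + 1)) w x']
    exact hN1 (n + 1) l α _
  · -- (hG′)
    intro α x' l w ν
    rw [GamΦ_eq_neg_wH, GamΦ_eq_neg_wH, hre, abs_neg, hcast, ← quo_sub_zsmul (N := Lc ^ (n + 1 + 1)) w x', add_sub_right_comm]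
    exact hN1' (n + 1) l α _ ν
  · -- (hH)
    intro κ' u' κ u
    rw [← quo_sub_zsmul (N := Lc ^ (n + 1 + 1)) u u']
    exact hN1 (n + 1) κ κ' _
  · -- (hK)
    intro β z' l' y
    rw [← quo_sub_zsmul (N := Lc ^ (n + 1 + 1)) y z']
    exact hN1 (n + 1) l' β _
  · -- (hK′)
    intro β z' l' y ν
    rw [← mul_sub, hcast, ← quo_sub_zsmul (N := Lc ^ (n + 1 + 1)) y z', add_sub_right_comm]
    exact hN1' (n + 1) l' β _ ν
  · -- (hB)
    intro s hs
    exact_mod_cast l1_le_of_mem_box1 hs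
  · -- (hT0)
    intro κ u w y l l'
    exact abs_wilsonA_le κ u w y _ _
  · intro κ u w y l l' hw
    exact wilsonA_eq_zero_of_left κ u w y l l' hw
  · intro κ u w y l l' hy
    exact wilsonA_eq_zero_of_right κ u w y l l' hy
  · intro κ u l l'
    exact wilsonA_sum_zero_offsets κ u l l'

end Generic

/-! ## §3 Row W at `d = 3`: the residual is `N⁰`, the constant is `n`-free -/

/-- [folklore] **ROW W OF THE SHAPE TABLE, MODULO (N1)∕(N1′)** (`SKELETON-S3.md` v1.1 §12.2 ∕ §16 «ROW W»; the hypothesis `hW` of the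
row owner's END `StencilSlotE3OfPieces.e3Shape_of_pieces` VERBATIM at `d = 3`, delivered as `∃ CW δW > 0`): at `d = 3` the residual
`N^{d−3}` of `e3W_unit_split` is `1`, so (N1) ∧ (N1′) in the adopted block-label `ℓ¹` currency (uniform over the levels `N = Lc^{j+1}`)
give an `n`-FREE constant.  Row W is thereby REDUCED IN THE KERNEL to leaf-16's two located leg estimates; nothing else is assumed. -/
theorem rowW_of_fineReadout {Lc : ℕ} [NeZero Lc] (cE : ℝ) {δ CH CH' : ℝ} (hδ : 0 < δ)
    (hN1 : ∀ (j : ℕ) (κ l : Fin (3 + 1)) (z : Fin (3 + 1) → ℤ),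
      |((Lc : ℝ) ^ (j + 1)) ^ (3 + 2) * wH (N := Lc ^ (j + 1)) κ l z| ≤ CH * Real.exp (-δ * l1 (quo (Lc ^ (j + 1)) z)))
    (hN1' : ∀ (j : ℕ) (κ l : Fin (3 + 1)) (z : Fin (3 + 1) → ℤ) (ν : Fin (3 + 1)),
      |((Lc : ℝ) ^ (j + 1)) ^ (3 + 2) * (wH (N := Lc ^ (j + 1)) κ l (z + Pi.single ν 1) - wH (N := Lc ^ (j + 1)) κ l z)| ≤
        CH' / (Lc : ℝ) ^ (j + 1) * Real.exp (-δ * l1 (quo (Lc ^ (j + 1)) z))) :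
    ∃ CW δW : ℝ, 0 < δW ∧ ∀ n : ℕ, LocStencil (fun κ' u' x' z' a b => ((Lc : ℝ) ^ (n + 1 + 1)) ^ (2 * (3 + 1)) *
      e3OfS (Lc ^ (n + 1 + 1)) (fun κ u => (cE * ((Lc : ℝ) ^ (3 + 1)) ^ (n + 1)) • wilsonA 3 κ u) κ' u' x' z' a b) CW δW := by
  refine ⟨|-(cE / (Lc : ℝ) ^ (3 + 1))| *
      ((((3 : ℕ) : ℝ) + 1) ^ 3 * ((box1 (3 + 1)).card : ℝ) ^ 2 * wBound 3 * CH * (((3 : ℕ) : ℝ) + 1) *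
        Real.exp (2 * δ * ((((3 : ℕ) : ℝ)) + 1)) * (CH' * CH + CH * CH') * Zl (3 + 1) (δ / 2)),
    δ / 2, half_pos hδ, fun n => ?_⟩
  have h := locStencil_wilson_piece (d := 3) cE hδ hN1 hN1' n
  have e : ((Lc : ℝ) ^ (n + 1 + 1)) ^ (((3 : ℕ) : ℤ) - 3) = 1 := by norm_num
  rw [e, mul_one] at h
  exact h

/-! ## §4 Currency adapters: leaf-16's sup-norm ∕ inverse-power forms of (N1)∕(N1′) ⇒ the adopted block-label `ℓ¹` forms -/

section Adapters

variable {Lc : ℕ} [NeZero Lc]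

/-- [folklore] **(N1) ADAPTER**: the sup-norm ∕ inverse-power form of the minimiser-column decay (the shape of leaf-16's
`FineReadoutDecay.exists_wH_decay`: `|wH_{Lc^(j+1)} κ l z| ≤ C·((Lc^(j+1))^{d+2})⁻¹·e^{−κ₀‖quo z‖∞}`) gives the adopted form
`|((Lc:ℝ)^(j+1))^(d+2)·wH κ l z| ≤ C·e^{−(κ₀/(d+1))|quo z|₁}`. -/
theorem legBound_of_supNorm_form {C κ₀ : ℝ} (hκ₀ : 0 ≤ κ₀)
    (h : ∀ (j : ℕ) (κ l : Fin (d + 1)) (z : Fin (d + 1) → ℤ), |wH (N := Lc ^ (j + 1)) κ l z| ≤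
      C * ((((Lc ^ (j + 1) : ℕ) : ℝ)) ^ (d + 2))⁻¹ * Real.exp (-(κ₀ * supNorm (quo (Lc ^ (j + 1)) z))))
    (j : ℕ) (κ l : Fin (d + 1)) (z : Fin (d + 1) → ℤ) :
    |((Lc : ℝ) ^ (j + 1)) ^ (d + 2) * wH (N := Lc ^ (j + 1)) κ l z| ≤
      C * Real.exp (-(κ₀ / ((d : ℝ) + 1)) * l1 (quo (Lc ^ (j + 1)) z)) := by
  have hL : (0 : ℝ) < (Lc : ℝ) := by exact_mod_cast Nat.pos_of_ne_zero (NeZero.ne Lc)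
  have hP : (0 : ℝ) < ((Lc : ℝ) ^ (j + 1)) ^ (d + 2) := by positivity
  have hcast : ((((Lc ^ (j + 1) : ℕ) : ℝ)) ^ (d + 2)) = ((Lc : ℝ) ^ (j + 1)) ^ (d + 2) := by push_cast; ring
  have h1 := h j κ l z
  rw [hcast] at h1
  have hC : 0 ≤ C := by
    have h0 : 0 ≤ C * (((Lc : ℝ) ^ (j + 1)) ^ (d + 2))⁻¹ * Real.exp (-(κ₀ * supNorm (quo (Lc ^ (j + 1)) z))) :=
      (abs_nonneg _).trans h1
    have := mul_nonneg (mul_nonneg h0 hP.le) (Real.exp_pos (κ₀ * supNorm (quo (Lc ^ (j + 1)) z))).le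
    rw [show C * (((Lc : ℝ) ^ (j + 1)) ^ (d + 2))⁻¹ * Real.exp (-(κ₀ * supNorm (quo (Lc ^ (j + 1)) z))) *
        ((Lc : ℝ) ^ (j + 1)) ^ (d + 2) * Real.exp (κ₀ * supNorm (quo (Lc ^ (j + 1)) z)) = C by
      rw [Real.exp_neg]; field_simp] at this
    exact this
  rw [abs_mul, abs_of_pos hP]
  calc ((Lc : ℝ) ^ (j + 1)) ^ (d + 2) * |wH (N := Lc ^ (j + 1)) κ l z|
      ≤ ((Lc : ℝ) ^ (j + 1)) ^ (d + 2) * (C * (((Lc : ℝ) ^ (j + 1)) ^ (d + 2))⁻¹ *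
          Real.exp (-(κ₀ * supNorm (quo (Lc ^ (j + 1)) z)))) := mul_le_mul_of_nonneg_left h1 hP.le
    _ = C * Real.exp (-(κ₀ * supNorm (quo (Lc ^ (j + 1)) z))) := by field_simp
    _ ≤ C * Real.exp (-(κ₀ / ((d : ℝ) + 1)) * l1 (quo (Lc ^ (j + 1)) z)) :=
        mul_le_mul_of_nonneg_left (exp_sup_le_exp_l1 hκ₀ _) hC

/-- [folklore] **(N1′) ADAPTER**: a sup-norm ∕ inverse-power form of the unit-gradient bound
(`|wH κ l (z + e_ν) − wH κ l z| ≤ C′·((Lc^(j+1))^{d+3})⁻¹·e^{−κ₀‖quo z‖∞}`, one power of `N` better than (N1)) gives the adopted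
form `|((Lc:ℝ)^(j+1))^(d+2)·(wH κ l (z + e_ν) − wH κ l z)| ≤ (C′/Lc^(j+1))·e^{−(κ₀/(d+1))|quo z|₁}`. -/
theorem legGrad_of_supNorm_form {C' κ₀ : ℝ} (hκ₀ : 0 ≤ κ₀)
    (h : ∀ (j : ℕ) (κ l : Fin (d + 1)) (z : Fin (d + 1) → ℤ) (ν : Fin (d + 1)),
      |wH (N := Lc ^ (j + 1)) κ l (z + Pi.single ν 1) - wH (N := Lc ^ (j + 1)) κ l z| ≤
        C' * ((((Lc ^ (j + 1) : ℕ) : ℝ)) ^ (d + 3))⁻¹ * Real.exp (-(κ₀ * supNorm (quo (Lc ^ (j + 1)) z))))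
    (j : ℕ) (κ l : Fin (d + 1)) (z : Fin (d + 1) → ℤ) (ν : Fin (d + 1)) :
    |((Lc : ℝ) ^ (j + 1)) ^ (d + 2) * (wH (N := Lc ^ (j + 1)) κ l (z + Pi.single ν 1) - wH (N := Lc ^ (j + 1)) κ l z)| ≤
      C' / (Lc : ℝ) ^ (j + 1) * Real.exp (-(κ₀ / ((d : ℝ) + 1)) * l1 (quo (Lc ^ (j + 1)) z)) := by
  have hL : (0 : ℝ) < (Lc : ℝ) := by exact_mod_cast Nat.pos_of_ne_zero (NeZero.ne Lc)
  have hM : (0 : ℝ) < (Lc : ℝ) ^ (j + 1) := by positivity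
  have hP : (0 : ℝ) < ((Lc : ℝ) ^ (j + 1)) ^ (d + 2) := by positivity
  have hcast : ((((Lc ^ (j + 1) : ℕ) : ℝ)) ^ (d + 3)) = ((Lc : ℝ) ^ (j + 1)) ^ (d + 2) * (Lc : ℝ) ^ (j + 1) := by push_cast; ring
  have h1 := h j κ l z ν
  rw [hcast] at h1
  have hC : 0 ≤ C' := by
    have h0 : 0 ≤ C' * (((Lc : ℝ) ^ (j + 1)) ^ (d + 2) * (Lc : ℝ) ^ (j + 1))⁻¹ *
        Real.exp (-(κ₀ * supNorm (quo (Lc ^ (j + 1)) z))) := (abs_nonneg _).trans h1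
    have := mul_nonneg (mul_nonneg h0 (mul_pos hP hM).le) (Real.exp_pos (κ₀ * supNorm (quo (Lc ^ (j + 1)) z))).le
    rw [show C' * (((Lc : ℝ) ^ (j + 1)) ^ (d + 2) * (Lc : ℝ) ^ (j + 1))⁻¹ * Real.exp (-(κ₀ * supNorm (quo (Lc ^ (j + 1)) z))) *
        (((Lc : ℝ) ^ (j + 1)) ^ (d + 2) * (Lc : ℝ) ^ (j + 1)) * Real.exp (κ₀ * supNorm (quo (Lc ^ (j + 1)) z)) = C' by
      rw [Real.exp_neg]; field_simp] at this
    exact this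
  rw [abs_mul, abs_of_pos hP]
  calc ((Lc : ℝ) ^ (j + 1)) ^ (d + 2) * |wH (N := Lc ^ (j + 1)) κ l (z + Pi.single ν 1) - wH (N := Lc ^ (j + 1)) κ l z|
      ≤ ((Lc : ℝ) ^ (j + 1)) ^ (d + 2) * (C' * (((Lc : ℝ) ^ (j + 1)) ^ (d + 2) * (Lc : ℝ) ^ (j + 1))⁻¹ *
          Real.exp (-(κ₀ * supNorm (quo (Lc ^ (j + 1)) z)))) := mul_le_mul_of_nonneg_left h1 hP.le
    _ = C' / (Lc : ℝ) ^ (j + 1) * Real.exp (-(κ₀ * supNorm (quo (Lc ^ (j + 1)) z))) := by field_simp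
    _ ≤ C' / (Lc : ℝ) ^ (j + 1) * Real.exp (-(κ₀ / ((d : ℝ) + 1)) * l1 (quo (Lc ^ (j + 1)) z)) :=
        mul_le_mul_of_nonneg_left (exp_sup_le_exp_l1 hκ₀ _) (div_nonneg hC hM.le)

/-- [folklore] **ROW W FROM THE SUP-NORM FORMS** (`d = 3`): leaf-16's `exists_wH_decay` shape for (N1) and the matching
inverse-power shape for (N1′) give row W with `δW = κ₀/8`. -/
theorem rowW_of_supNorm_forms (cE : ℝ) {κ₀ C C' : ℝ} (hκ₀ : 0 < κ₀)
    (hN1 : ∀ (j : ℕ) (κ l : Fin (3 + 1)) (z : Fin (3 + 1) → ℤ), |wH (N := Lc ^ (j + 1)) κ l z| ≤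
      C * ((((Lc ^ (j + 1) : ℕ) : ℝ)) ^ (3 + 2))⁻¹ * Real.exp (-(κ₀ * supNorm (quo (Lc ^ (j + 1)) z))))
    (hN1' : ∀ (j : ℕ) (κ l : Fin (3 + 1)) (z : Fin (3 + 1) → ℤ) (ν : Fin (3 + 1)),
      |wH (N := Lc ^ (j + 1)) κ l (z + Pi.single ν 1) - wH (N := Lc ^ (j + 1)) κ l z| ≤
        C' * ((((Lc ^ (j + 1) : ℕ) : ℝ)) ^ (3 + 3))⁻¹ * Real.exp (-(κ₀ * supNorm (quo (Lc ^ (j + 1)) z)))) :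
    ∃ CW δW : ℝ, 0 < δW ∧ ∀ n : ℕ, LocStencil (fun κ' u' x' z' a b => ((Lc : ℝ) ^ (n + 1 + 1)) ^ (2 * (3 + 1)) *
      e3OfS (Lc ^ (n + 1 + 1)) (fun κ u => (cE * ((Lc : ℝ) ^ (3 + 1)) ^ (n + 1)) • wilsonA 3 κ u) κ' u' x' z' a b) CW δW :=
  rowW_of_fineReadout cE (δ := κ₀ / ((3 : ℕ) + 1)) (by positivity)
    (legBound_of_supNorm_form (d := 3) hκ₀.le hN1) (legGrad_of_supNorm_form (d := 3) hκ₀.le hN1')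

end Adapters

/-! ## §5 Row W at `d = 3`, UNCONDITIONAL: (N1) ∧ (N1′) BY NAME -/

/-- NOT IN PRINT; OUR PROOF.  **ROW W OF THE SHAPE TABLE AT `d = 3`, UNCONDITIONALLY** (LEAVES.md PART III § III.S row S3-W; the hypothesis `hW` of the
row owner's END `StencilSlotE3OfPieces.e3Shape_of_pieces` VERBATIM at `d = 3` — the binder `hW` of the TREE module p206983 (l.158–159) with `d := 3`,
first copied from the staged draft 2cc3c5eb8d83de1a — delivered as
`∃ CW δW, 0 < δW ∧ ∀ n, …`): for every blocking factor `Lc ≥ 1` and every Wilson coefficient `cE`, the Wilson piece of the normalised third jet of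
Bałaban's `U = 1` block-spin step at member `n+2` is a local stencil family with ONE rate `δW > 0` and ONE constant `CW`, both free of `n`.
Inputs BY NAME: W1 `WilsonVertexSumZero.wilsonA_sum_zero_box` (leaf-15), W3 `TaylorTrilinear.locStencil_of_trilinear` (leaf-19), the unit split
`E3UnitSplit.e3W_unit_split` (leaf-01), `ResolventComposition.GamΦ_eq_neg_wH` (an5), and the two leg estimates (N1) `FineReadoutDecay.exists_wH_decay`
(leaf-16) ∕ (N1′) `FineReadoutGradientDecay.exists_wH_grad_decay` (leaf-19 packaging of leaf-16's E3A5) through `exists_wH_decay_and_grad`; constants: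
`δW = κ₀/8`, `CW = |cE/Lc⁴|·4³·81²·wBound 3·C·4·e^{2κ₀}·2CC′·Zl 4 (κ₀/8)` with `(κ₀, C, C′)` those of `exists_wH_decay_and_grad` (the adapters run at the block-`ℓ¹` rate `δ = κ₀/4`).  ONE of twelve
analytic rows; discharges NOTHING of (hS, hSall) by itself; NOT BetaPertH, NOT continuum, NOT Clay. -/
theorem rowW_three {Lc : ℕ} [NeZero Lc] (cE : ℝ) :
    ∃ CW δW : ℝ, 0 < δW ∧ ∀ n : ℕ, LocStencil (fun κ' u' x' z' a b => ((Lc : ℝ) ^ (n + 1 + 1)) ^ (2 * (3 + 1)) *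
      e3OfS (Lc ^ (n + 1 + 1)) (fun κ u => (cE * ((Lc : ℝ) ^ (3 + 1)) ^ (n + 1)) • wilsonA 3 κ u) κ' u' x' z' a b) CW δW := by
  obtain ⟨κ₀, C, C', hκ₀, -, -, hN1, hN1'⟩ := exists_wH_decay_and_grad (Lc := Lc)
  exact rowW_of_supNorm_forms cE hκ₀ hN1 hN1'

end Summit.QuantumFields.BalabanUV.Beta.GAN24.TaylorRowW

end
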